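import Summits.BirchSwinnertonDyer.Rank1Residual.X2.EulerFactorInvariants
import Summits.BirchSwinnertonDyer.Rank1Residual.X1.LambdaSqueezeAlgebra
import Literature.NumberTheory.EllipticCurves.IwasawaSelmer
import HarnessLib

/-!
# Class X2a (odd multiplicative Eisenstein prime): the CANCELLATION CORE of the Greenberg–Vatsal
# assembly at `p ‖ N` — `λ(X) = ord_T(f_E mod p)` for `μ(X) = 0`, and "unit content + `T`-order
# `λ(X) + Σδ + e` of `b · ∏𝒫_ℓ`" ⟹ "unit content + `ord_T(b̄) = ord_T(f̄_E) + e` of `b`"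
# (cell `b2b-bsdres`, unit `b2b-bsdres-eisenstein-p2`, gen 17; part 1 of 2, see
# `GreenbergVatsalAnalyticTransfer`)

HONEST FRAMING (run/shared/lean/b2b/bsd-rank1-residual/, verbatim in every file): the goal of the
cell is to DELETE the COMBINATION-SHAPED residual classes of the Birch–Swinnerton-Dyer formula for
ALL analytic-rank `≤ 1` elliptic curves over `ℚ` — "full BSD formula for every rank `≤ 1` curve in
class `C`" assembled STRICTLY from published theorems — so that the rank-`≤ 1` remainder becomes
exactly the CONSTRUCTION-SHAPED classes, which are TYPED (missing-input `Prop`s), NOT attempted.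
This is not "finishing BSD". Research route; NO CLAIM BEYOND STATED CLASSES; nothing here changes
a label. THEOREMS ONLY (no `def`, no named fact, no `sorry`).

WHAT (X2-GAP §21.6 (iv), §22). The flag's named fact
`GreenbergVatsal2000.lambda_muAnal_multiplicative_of_gvPar` concludes, for `b ∈ Λ` with
`ι b = ϖ · L(E/ℚ, T)`: unit content and `ord_T(b mod p) = ord_T(T^e · f_E mod p)`. Greenberg–Vatsal
reach it through the NON-PRIMITIVE function (`b^{Σ₀} = b · ∏_{ℓ∈Σ₀} 𝒫_ℓ`, gen-17 Literature
definition `GreenbergVatsal2000.eulerFactorProduct`) and display (9) (gen-17 kernel theorem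
`EulerFactorInvariants.order_map_toZMod_mul_eulerFactorProduct`). This file is the `E`-light core:

* §1 dictionary: `order_map_eq_of_forall_map_eq_zero_iff` (the `T`-order of a reduction depends
  only on WHICH coefficients the map kills), `order_map_toZMod_eq_order_red` (`ℤ/p` vs the residue
  field `𝔽_p`: the two reductions used in the tree), `natCast_lam_eq_order_map_toZMod`
  (`λ(g) = ord_T(g mod p)` for `g` of unit content), **`natCast_lambdaInvariant_eq_order_map_toZMod`**
  (for a dual datum `D` with `X` f.g. torsion, `μ(X) = 0`, `char X = (f_E)`: `λ(X) = ord_T(f_E mod p)`;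
  tree theorems `lam_generator_eq_lambdaInvariant`, `mu_eq_zero_iff_hasUnitContent`),
  `order_map_toZMod_X_mul` (the trivial-zero factor `T` adds `1`), `pow_right_injective_prime`.
* §2 **`unitContent_and_order_eq_of_order_nonPrimitive_eq`**: if `b · ∏_{ℓ∈Σ₀} 𝒫_ℓ` has unit
  content and `T`-order `λ(X) + Σ_{ℓ∈Σ₀} δ_E^{(ℓ)} + e` (`Σ₀ ∌ p`, `p` odd), then `b` has unit content
  and `ord_T(b mod p) = ord_T(f_E mod p) + e`.

The companion `X2/GreenbergVatsalAnalyticTransfer.lean` feeds this with gen 16's devissage count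
(GV display (16) at `p ‖ N`) and the two printed inputs (character counts; Thm. (3.11) + (28)).

References: [GreenbergVatsal2000] §1 (8)–(9), p. 20; §3 p. 43; [Washington1997] §7.1, §13.2;
HOME/b2b-bsdres-eisenstein-p2/X2-GAP.md §22.
-/

set_option autoImplicit false

noncomputable section

open scoped Classical

open PowerSeries NumberField IsDedekindDomain Field WeierstrassCurve
  Literature.NumberTheory.EllipticCurves Literature.NumberTheory.EllipticCurves.GreenbergVatsal2000
  Summit.BirchSwinnertonDyer.Rank1Residual.X1.MuLambda
  Summit.BirchSwinnertonDyer.Rank1Residual.X1.ParitySqueeze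
  Summit.BirchSwinnertonDyer.Rank1Residual.X2.EulerFactorAlgebra
  Summit.BirchSwinnertonDyer.Rank1Residual.X2.EulerFactorInvariants

namespace Summit.BirchSwinnertonDyer.Rank1Residual.X2.GreenbergVatsalAnalyticTransferCore

/-! ## §1. Dictionary: `λ(X) = ord_T(f_E mod p)` when `μ(X) = 0` -/

section Dictionary

variable {p : ℕ} [hp : Fact p.Prime]

/-- The `T`-order of the reduction of a power series along a ring map depends only on WHICH
coefficients the map kills. -/
theorem order_map_eq_of_forall_map_eq_zero_iff {R S S' : Type*} [Semiring R] [Semiring S]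
    [Semiring S'] (φ : R →+* S) (ψ : R →+* S') (h : ∀ x, φ x = 0 ↔ ψ x = 0) (g : PowerSeries R) :
    (PowerSeries.map φ g).order = (PowerSeries.map ψ g).order := by
  apply le_antisymm
  · refine PowerSeries.le_order _ _ fun i hi => ?_
    rw [PowerSeries.coeff_map, ← h, ← PowerSeries.coeff_map]
    exact PowerSeries.coeff_of_lt_order i hi
  · refine PowerSeries.le_order _ _ fun i hi => ?_
    rw [PowerSeries.coeff_map, h, ← PowerSeries.coeff_map]
    exact PowerSeries.coeff_of_lt_order i hi

/-- `ord_T(g mod p)` is the same whether "mod `p`" means `ℤ_p → ℤ/p` (`PadicInt.toZMod`, the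
reduction used by `lambda_muAnal_multiplicative_of_gvPar`) or `ℤ_p → 𝔽_p = ℤ_p/𝔪`
(`IsLocalRing.residue`, the reduction `red` behind the cell's `lam`). -/
theorem order_map_toZMod_eq_order_red (g : IwasawaAlgebra p) :
    (PowerSeries.map (PadicInt.toZMod (p := p)) g).order = (red g).order := by
  refine order_map_eq_of_forall_map_eq_zero_iff _ _ (fun x => ?_) g
  rw [← RingHom.mem_ker, PadicInt.ker_toZMod, IsLocalRing.residue_eq_zero_iff]

/-- For `g ∈ Λ` of unit content (`μ(g) = 0`): `λ(g) = ord_T(g mod p)` (as elements of `ℕ∞`). -/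
theorem natCast_lam_eq_order_map_toZMod {g : IwasawaAlgebra p} (hg : HasUnitContent g) :
    ((lam g : ℕ) : ℕ∞) = (PowerSeries.map (PadicInt.toZMod (p := p)) g).order := by
  have hred : red g ≠ 0 := by
    rw [Ne, red_eq_zero_iff]
    exact (hasUnitContent_iff_not_C_dvd g).mp hg
  have hfac : g = PowerSeries.C ((p : ℤ_[p]) ^ 0) * g := by rw [pow_zero, map_one, one_mul]
  obtain ⟨-, hpf⟩ := mu_eq_and_pfree_eq hred hfac
  rw [lam, hpf, order_map_toZMod_eq_order_red,
    ENat.coe_toNat (fun h => hred (PowerSeries.order_eq_top.mp h))]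

/-- **`λ(X) = ord_T(f_E mod p)`**: for a dual datum `D` whose Iwasawa module `X` is finitely
generated and torsion with `μ(X) = 0`, and ANY generator `f_E` of `char_Λ X` (tree theorems
`lam_generator_eq_lambdaInvariant`, `mu_eq_zero_iff_hasUnitContent`). -/
theorem natCast_lambdaInvariant_eq_order_map_toZMod {K : Type*} [Field K] [NumberField K]
    {W : WeierstrassCurve K} {κ : ZpExtension K p} {γ : absoluteGaloisGroup K}
    (D : W.SelmerDualData κ γ) [Module.Finite (IwasawaAlgebra p) D.X] (hX : D.IsTorsion)
    (hμ : D.mu = 0) {fE : IwasawaAlgebra p} (hchar : D.charIdeal = Ideal.span {fE}) :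
    ((lambdaInvariant p D.X : ℕ) : ℕ∞) = (PowerSeries.map (PadicInt.toZMod (p := p)) fE).order := by
  have hfE : HasUnitContent fE := (mu_eq_zero_iff_hasUnitContent D hX hchar).mp hμ
  have hfE0 : fE ≠ 0 := by
    rintro rfl
    obtain ⟨n, hn⟩ := hfE
    rw [map_zero] at hn
    exact not_isUnit_zero hn
  rw [← lam_generator_eq_lambdaInvariant D.X hX hfE0 hchar, natCast_lam_eq_order_map_toZMod hfE]

/-- `ord_T(T·g mod p) = ord_T(g mod p) + 1` (the trivial-zero factor). -/
theorem order_map_toZMod_X_mul (g : IwasawaAlgebra p) :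
    (PowerSeries.map (PadicInt.toZMod (p := p)) (PowerSeries.X * g)).order =
      (PowerSeries.map (PadicInt.toZMod (p := p)) g).order + 1 := by
  rw [map_mul, PowerSeries.map_X, PowerSeries.order_mul, PowerSeries.order_X, add_comm]

/-- Exponent extraction: `p^a = p^b → a = b`. -/
theorem pow_right_injective_prime {a b : ℕ} (h : p ^ a = p ^ b) : a = b :=
  Nat.pow_right_injective hp.out.two_le h

end Dictionary

/-! ## §2. The cancellation: `(C)+(D) ⟹` the clause, given the `T`-order `λ(X) + Σδ + e` -/

section Core

variable (W : WeierstrassCurve ℚ) {p : ℕ} [hp : Fact p.Prime] {κ : ZpExtension ℚ p}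
  {γ : absoluteGaloisGroup ℚ} (S₀ : Finset (HeightOneSpectrum (𝓞 ℚ)))

/-- **The cancellation step (C)+(D) ⟹ clause, abstractly.** If `b^{Σ₀} = b · ∏_{ℓ∈Σ₀} 𝒫_ℓ` has
unit content and `T`-order `λ(X) + Σ_{ℓ∈Σ₀} δ_E^{(ℓ)} + e`, where `X` (f.g. torsion, `μ = 0`) has
`char X = (f_E)`, then `b` has unit content and `ord_T(b mod p) = ord_T(f_E mod p) + e`: display (9)
removes `Σδ`, the dictionary turns `λ(X)` into `ord_T(f_E mod p)`. -/
theorem unitContent_and_order_eq_of_order_nonPrimitive_eq (hp2 : p ≠ 2)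
    (hS₀ : ∀ v ∈ S₀, Rat.HeightOneSpectrum.natGenerator v ≠ p)
    (D : W.SelmerDualData κ γ) [Module.Finite (IwasawaAlgebra p) D.X] (hX : D.IsTorsion)
    (hμ : D.mu = 0) {fE : IwasawaAlgebra p} (hchar : D.charIdeal = Ideal.span {fE})
    {b : IwasawaAlgebra p} (e : ℕ) (hbu : HasUnitContent (b * eulerFactorProduct W p S₀))
    (hord : (PowerSeries.map (PadicInt.toZMod (p := p)) (b * eulerFactorProduct W p S₀)).order =
      ((lambdaInvariant p D.X + ∑ v ∈ S₀, delta W p v + e : ℕ) : ℕ∞)) :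
    HasUnitContent b ∧
      (PowerSeries.map (PadicInt.toZMod (p := p)) b).order =
        (PowerSeries.map (PadicInt.toZMod (p := p)) fE).order + e := by
  have hbu' : HasUnitContent b := ((hasUnitContent_mul_iff _ _).mp hbu).1
  refine ⟨hbu', ?_⟩
  rw [order_map_toZMod_mul_eulerFactorProduct W S₀ hp2 hS₀ b] at hord
  rw [← natCast_lambdaInvariant_eq_order_map_toZMod D hX hμ hchar]
  have hfin : (PowerSeries.map (PadicInt.toZMod (p := p)) b).order ≠ ⊤ := by
    rw [Ne, PowerSeries.order_eq_top]
    exact (hasUnitContent_iff_map_toZMod_ne_zero b).mp hbu'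
  obtain ⟨n, hn⟩ := ENat.ne_top_iff_exists.mp hfin
  rw [← hn] at hord ⊢
  have h' : n + ∑ v ∈ S₀, delta W p v = lambdaInvariant p D.X + ∑ v ∈ S₀, delta W p v + e := by
    exact_mod_cast hord
  have hn' : n = lambdaInvariant p D.X + e := by omega
  rw [hn']
  norm_cast

end Core

end Summit.BirchSwinnertonDyer.Rank1Residual.X2.GreenbergVatsalAnalyticTransferCore

end
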